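import Mathlib
import Literature.NumberTheory.LFunctions.SemimultiplicativeMoebiusZones

/-!
# `QuadraticDigitPhases` (stmt-QuantumAdvantage-1391), line `Sketch` — stub `stub_blockCesaro`

Banded branch of the crux, Kátai sub-branch. Let `g : ℕ → ℂ` be `1`-bounded, `2`-quasimultiplicative
with gap `≤ S` (Konieczny 2020, Definition 3.1: `g (x + y) = g x * g y` whenever `y < 2^l` and
`2^(l+S) ∣ x`) and Cesàro-null. Then the sums of `g` over ALL aligned dyadic blocks
`[a 2^l, (a+1) 2^l)` are uniformly `o(2^l)`.

Proof (block recursion, no digit combinatorics). Write `G(Z) = Σ_{y<Z} g y` and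
`B(l) = sup_a ‖Σ_{y<2^l} g (a 2^l + y)‖`. Splitting `y < 2^(j+S)` as `y = c 2^j + y'` with
`c < 2^S`, `y' < 2^j`: for `c = 0` quasimultiplicativity at level `j` with `x = a 2^(j+S)` gives
`Σ_{y'} g (a 2^(j+S) + y') = g (a 2^(j+S)) · G(2^j)`, of norm `≤ ‖G(2^j)‖ ≤ ε 2^j` once `j ≥ j₀`
(Cesàro-null evaluated along `N = 2^j`, `dyadic_partial_sums_small`); for `c ≠ 0` the inner sum is a
block sum at level `j`. Hence `B(j+S) ≤ (2^S - 1) B(j) + ε 2^j` (`block_step`), and iterating `t`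
times from the trivial bound `B ≤ 2^l` gives `B(l) ≤ ((1 - 2^{-S})^t + ε) 2^l` for
`l ≥ j₀ + t S` (`block_iter`). Choosing `t` with `(1 - 2^{-S})^t ≤ δ/2` and `ε = δ/2` finishes.
-/

set_option linter.dupNamespace false -- D-0017: single-problem summit ⇒ `QuantumAdvantage.QuantumAdvantage` by design

namespace Summit.QuantumAdvantage.QuantumAdvantage.Theorems.MobiusLadderQuadraticDigitPhasesStubBlockCesaro

open Finset Filter
open Literature.NumberTheory.LFunctions

/-- Cesàro-null along powers of two: if `N⁻¹ Σ_{m<N} g m → 0` then for every `ε > 0`,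
`‖Σ_{m<2^j} g m‖ ≤ ε 2^j` for all large `j`. [folklore] -/
theorem dyadic_partial_sums_small {g : ℕ → ℂ}
    (hT : Tendsto (fun N : ℕ => (N : ℂ)⁻¹ * ∑ m ∈ range N, g m) atTop (nhds 0))
    {ε : ℝ} (hε : 0 < ε) :
    ∃ j₀ : ℕ, ∀ j : ℕ, j₀ ≤ j → ‖∑ m ∈ range (2 ^ j), g m‖ ≤ ε * (2 : ℝ) ^ j := by
  obtain ⟨N₀, hN₀⟩ := Metric.tendsto_atTop.1 hT ε hε
  refine ⟨N₀, fun j hj => ?_⟩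
  have h2j : N₀ ≤ 2 ^ j := hj.trans (Nat.lt_two_pow_self).le
  have h := hN₀ (2 ^ j) h2j
  rw [dist_zero_right, norm_mul, norm_inv, Complex.norm_natCast] at h
  push_cast at h
  have hpos : (0 : ℝ) < (2 : ℝ) ^ j := by positivity
  have h' := (inv_mul_lt_iff₀ hpos).1 h
  linarith

/-- One level of the block recursion. If `‖Σ_{m<2^j} g m‖ ≤ ε 2^j` and every aligned block sum at
level `j` has norm `≤ B 2^j`, then every aligned block sum at level `j + S` has norm
`≤ ((2^S - 1) B + ε) 2^j`: the sub-block with top `S` digits zero factorises through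
quasimultiplicativity, the other `2^S - 1` sub-blocks are level-`j` blocks. [folklore] -/
theorem block_step {S : ℕ} {g : ℕ → ℂ} (hg1 : ∀ m, ‖g m‖ ≤ 1) (hq : Konieczny.IsQuasimult 2 S g)
    {ε B : ℝ} (j : ℕ) (hG : ‖∑ m ∈ range (2 ^ j), g m‖ ≤ ε * (2 : ℝ) ^ j)
    (hB : ∀ a : ℕ, ‖∑ y ∈ range (2 ^ j), g (a * 2 ^ j + y)‖ ≤ B * (2 : ℝ) ^ j) (a : ℕ) :
    ‖∑ y ∈ range (2 ^ (j + S)), g (a * 2 ^ (j + S) + y)‖ ≤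
      (((2 : ℝ) ^ S - 1) * B + ε) * (2 : ℝ) ^ j := by
  rw [Konieczny.sum_range_pow_add]
  obtain ⟨P, hP⟩ : ∃ P : ℕ, 2 ^ S = P + 1 := ⟨2 ^ S - 1, by have := Nat.two_pow_pos S; omega⟩
  have hPR : ((2 : ℝ) ^ S - 1) = (P : ℝ) := by
    have h : ((2 ^ S : ℕ) : ℝ) = (P : ℝ) + 1 := by exact_mod_cast hP
    push_cast at h
    linarith
  rw [hP, sum_range_succ']
  simp only [zero_mul, zero_add]
  -- the head sub-block (top `S` digits zero) factorises
  have hhead : ∑ lo ∈ range (2 ^ j), g (a * 2 ^ (j + S) + lo) =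
      g (a * 2 ^ (j + S)) * ∑ lo ∈ range (2 ^ j), g lo := by
    rw [mul_sum]
    refine sum_congr rfl fun lo hlo => ?_
    exact hq j _ _ (mem_range.1 hlo) (dvd_mul_left _ _)
  -- the other sub-blocks are aligned blocks at level `j`
  have htail : ∀ c ∈ range P,
      ‖∑ lo ∈ range (2 ^ j), g (a * 2 ^ (j + S) + ((c + 1) * 2 ^ j + lo))‖ ≤ B * (2 : ℝ) ^ j := by
    intro c _
    have heq : ∀ lo : ℕ, a * 2 ^ (j + S) + ((c + 1) * 2 ^ j + lo) =
        (a * 2 ^ S + (c + 1)) * 2 ^ j + lo := fun lo => by ring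
    simp_rw [heq]
    exact hB _
  calc ‖∑ c ∈ range P, ∑ lo ∈ range (2 ^ j), g (a * 2 ^ (j + S) + ((c + 1) * 2 ^ j + lo)) +
          ∑ lo ∈ range (2 ^ j), g (a * 2 ^ (j + S) + lo)‖
      ≤ ∑ c ∈ range P, ‖∑ lo ∈ range (2 ^ j), g (a * 2 ^ (j + S) + ((c + 1) * 2 ^ j + lo))‖ +
          ‖g (a * 2 ^ (j + S))‖ * ‖∑ lo ∈ range (2 ^ j), g lo‖ := by
        rw [hhead, ← norm_mul]
        exact (norm_add_le _ _).trans (add_le_add (norm_sum_le _ _) le_rfl)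
    _ ≤ ∑ c ∈ range P, B * (2 : ℝ) ^ j + 1 * (ε * (2 : ℝ) ^ j) :=
        add_le_add (sum_le_sum fun c hc => htail c hc)
          (mul_le_mul (hg1 _) hG (norm_nonneg _) zero_le_one)
    _ = (((2 : ℝ) ^ S - 1) * B + ε) * (2 : ℝ) ^ j := by
        rw [sum_const, card_range, nsmul_eq_mul, hPR]
        ring

/-- Iterating the block recursion `t` times from the trivial bound: if `‖Σ_{m<2^j} g m‖ ≤ ε 2^j`
for all `j ≥ j₀`, then every aligned block sum at level `l ≥ j₀ + t S` has norm
`≤ ((1 - 2^{-S})^t + ε) 2^l`. [folklore] -/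
theorem block_iter {S : ℕ} {g : ℕ → ℂ} (hg1 : ∀ m, ‖g m‖ ≤ 1) (hq : Konieczny.IsQuasimult 2 S g)
    {ε : ℝ} (hε : 0 ≤ ε) (j₀ : ℕ)
    (hG : ∀ j : ℕ, j₀ ≤ j → ‖∑ m ∈ range (2 ^ j), g m‖ ≤ ε * (2 : ℝ) ^ j) :
    ∀ t l : ℕ, j₀ + t * S ≤ l → ∀ a : ℕ,
      ‖∑ y ∈ range (2 ^ l), g (a * 2 ^ l + y)‖ ≤
        ((1 - 1 / (2 : ℝ) ^ S) ^ t + ε) * (2 : ℝ) ^ l := by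
  intro t
  induction t with
  | zero =>
      intro l _ a
      have h1 := Konieczny.norm_sum_range_le_of_le_one hg1 (2 ^ l) (fun y => a * 2 ^ l + y)
      push_cast at h1
      calc ‖∑ y ∈ range (2 ^ l), g (a * 2 ^ l + y)‖ ≤ (2 : ℝ) ^ l := h1
        _ ≤ ((1 - 1 / (2 : ℝ) ^ S) ^ 0 + ε) * (2 : ℝ) ^ l := by
            rw [pow_zero]
            exact le_mul_of_one_le_left (by positivity) (by linarith)
  | succ t ih =>
      intro l hl a
      rw [add_one_mul, ← add_assoc] at hl
      obtain ⟨j, rfl⟩ : ∃ j, l = j + S := ⟨l - S, by omega⟩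
      have hj : j₀ + t * S ≤ j := by omega
      have hj₀ : j₀ ≤ j := le_trans (Nat.le_add_right _ _) hj
      have hstep := block_step hg1 hq j (hG j hj₀) (fun a' => ih j hj a') a
      have hX : (2 : ℝ) ^ S ≠ 0 := by positivity
      calc ‖∑ y ∈ range (2 ^ (j + S)), g (a * 2 ^ (j + S) + y)‖
          ≤ (((2 : ℝ) ^ S - 1) * ((1 - 1 / (2 : ℝ) ^ S) ^ t + ε) + ε) * (2 : ℝ) ^ j := hstep
        _ = ((1 - 1 / (2 : ℝ) ^ S) ^ (t + 1) + ε) * (2 : ℝ) ^ (j + S) := by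
            rw [pow_succ, pow_add]
            field_simp
            ring

/-- **Stub `stub_blockCesaro`** (PROVABLE, M) of the line `Sketch` for the crux
`MobiusLadder.QuadraticDigitPhases`: a `1`-bounded, `2`-quasimultiplicative (gap `≤ S`,
Konieczny 2020, Definition 3.1), Cesàro-null sequence `g` has uniformly small sums over all aligned
dyadic blocks: for every `δ > 0`, `‖Σ_{y<2^l} g (a 2^l + y)‖ ≤ δ 2^l` for all large `l` and all `a`.
[cite: Konieczny2020, Definition 3.1] -/
theorem stub_blockCesaro :
    ∀ (S : ℕ) (g : ℕ → ℂ), (∀ m, ‖g m‖ ≤ 1) →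
      Literature.NumberTheory.LFunctions.Konieczny.IsQuasimult 2 S g →
      Tendsto (fun N : ℕ => (N : ℂ)⁻¹ * ∑ m ∈ range N, g m) atTop (nhds 0) →
      ∀ δ : ℝ, 0 < δ → ∃ l₀ : ℕ, ∀ l : ℕ, l₀ ≤ l → ∀ a : ℕ,
        ‖∑ y ∈ range (2 ^ l), g (a * 2 ^ l + y)‖ ≤ δ * (2 : ℝ) ^ l := by
  intro S g hg1 hq hT δ hδ
  have hρ1 : 1 - 1 / (2 : ℝ) ^ S < 1 := by
    have : 0 < 1 / (2 : ℝ) ^ S := by positivity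
    linarith
  obtain ⟨t, ht⟩ := exists_pow_lt_of_lt_one (half_pos hδ) hρ1
  obtain ⟨j₀, hj₀⟩ := dyadic_partial_sums_small hT (half_pos hδ)
  refine ⟨j₀ + t * S, fun l hl a => ?_⟩
  calc ‖∑ y ∈ range (2 ^ l), g (a * 2 ^ l + y)‖
      ≤ ((1 - 1 / (2 : ℝ) ^ S) ^ t + δ / 2) * (2 : ℝ) ^ l :=
        block_iter hg1 hq (half_pos hδ).le j₀ hj₀ t l hl a
    _ ≤ δ * (2 : ℝ) ^ l := by
        apply mul_le_mul_of_nonneg_right _ (by positivity)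
        linarith [ht.le]

end Summit.QuantumAdvantage.QuantumAdvantage.Theorems.MobiusLadderQuadraticDigitPhasesStubBlockCesaro
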